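import Summits.BirchSwinnertonDyer.Rank1Residual.X11b.KummerLocalIndex
import Summits.BirchSwinnertonDyer.Rank1Residual.X11b.PerfectPairingAnnihilators
import Literature.NumberTheory.EllipticCurves.CasselsTateLemma615
import Literature.NumberTheory.EllipticCurves.LocalEulerCharacteristicTorsion
import Literature.NumberTheory.Automorphic.AdicCompletionLocalField
import HarnessLib

/-!
# Class X11b, routes p2/R1: RELAXING THE SELMER CONDITION AT ONE FINITE PLACE —
# `[H¹_{𝓛, ⊤ at v₀}(K, E[n]) : Sel⁽ⁿ⁾(E/K)] ≤ [E(K_{v₀}) : nE(K_{v₀}) + im E(K)]` by Poitou–Tate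
# (cell `b2b-bsdres`, sub-cell `multr1-p2`, gen 15)

HONEST FRAMING (verbatim, cell `b2b-bsdres`): the goal of the cell is to DELETE the
COMBINATION-SHAPED residual classes for ALL analytic-rank `≤ 1` curves over `ℚ` — "full BSD
formula for every rank `≤ 1` curve in class `C`" assembled STRICTLY from published theorems — so
that the rank-`≤ 1` remainder becomes exactly the CONSTRUCTION-SHAPED classes, which are TYPED
(missing-input Props), NOT attempted; this is not "finishing BSD". Research route `p2` for class
X11b; no claim beyond the stated class; nothing booked; X11b stays CONSTRUCTION-SHAPED. Two definitions with bodies (the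
bundled local Weil pairings `weilLocalPairing`, `invWeilPairing` — plumbing, nothing asserted) and
theorems; no `sorry`; no new named fact (consumes the tree's `poitouTate_sum_localTatePairing_eq_zero`
and `localEulerPoincareCharacteristic` as hypotheses).

## What this file proves — the DUALITY HALF of Jetchev–Skinner–Wan 2017 Prop. 3.2.1, `≤`, finite level

For an elliptic curve `E = W` over a number field `K`, a prime power `n`, a finite place `v₀`, with
`H¹_{𝓛, ⊤ at v₀}(K, E[n]) = kummerOutside W n {v₀}` (Kummer condition at every place `≠ v₀`, none at
`v₀`; tree `CasselsTateLemma615`) and `Sel⁽ⁿ⁾(E/K) = selmerGroup W n`: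

* `invWeilPairing_eq_zero_of_mem` — isotropy `inv_v(x ∪ₑ y) = 0` on `𝓛_v × 𝓛_v` at every place
  (tree: Poonen–Rains, discharged);
* **`invWeilPairing_localization_eq_zero_of_mem_kummerOutside`** — RECIPROCITY: for
  `x ∈ H¹_{𝓛, ⊤ at v₀}` and `P ∈ E(K)`, `inv_{v₀}(loc_{v₀} x ∪ₑ loc_{v₀} κ P) = 0` (all other local
  terms of the Poitou–Tate sum vanish by isotropy; tree `sum_inv_weilCupProduct_localization_eq_zero`);
* `invWeilPairing_bijective` — the left adjoint of `inv_{v₀}(· ∪ₑ ·)` on `H¹(K_{v₀}, E[n])` is bijective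
  (tree's PROVED local duality `eq_zero_of_forall_weilCupProduct_eq_zero_inr` + counting);
* **`relIndex_selmerGroup_kummerOutside_le`**: `[H¹_{𝓛,⊤ at v₀} : Sel⁽ⁿ⁾] ≤ [E(K_{v₀}) : nE(K_{v₀}) + im E(K)]`
  given a Poitou–Tate family (`IsPerfect`, `SumLocalTermEqZero`) and the count
  `#H¹(K_{v₀}, E[n]) = #𝓛_{v₀}²`: the quotient embeds by `loc_{v₀}` into `(loc H¹_{𝓛,⊤} + 𝓛)/𝓛 ⊆ N/𝓛`,
  `N` = annihilator of `loc(κ E(K))` (reciprocity + isotropy), `#N · #loc(κE(K)) = #H¹(K_{v₀}, E[n]) =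
  #𝓛²` (sibling's `natCard_annLeft_mul`), so `[N : 𝓛] = [𝓛 : loc κ E(K)]` = the Kummer index
  (`KummerIndex.relIndex_map_res_range_kummerMapTorsion`);
* **`relIndex_selmerGroup_kummerOutside_le_of_facts`** — the same from the two NAMED FACTS
  `poitouTate_sum_localTatePairing_eq_zero K` (Milne I 4.10(b)) and
  `localEulerPoincareCharacteristic K_{v₀}` (Milne I 2.8, via `natCard_galoisCohomology_one_torsion_adicCompletion_eq_sq`).

Role for route p2: at `v₀ = 𝔭̄` this is "Part B" of the input (d) `P2SelmerCardBoundAt` (JSW Prop.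
3.2.1 `≤`): Castella's `Sel_𝔭(K, E[p^∞])[p^k]` is contained in `H¹_{𝓛, ⊤ at 𝔭̄}(K, E[p^k]) ∩ ker loc_𝔭`
(limit layer, sibling sub-cell `multr1-p1`), and the right-hand index is `p^{min(k, e)}`,
`e = (ord_p log_ω P − 1) − ord_p[E(K):ℤP] + ord_p c_p` (`BDPRouteLocalIndex`). Nothing booked;
labels unchanged.

References: [JetchevSkinnerWan2017] Prop. 3.2.1 (arXiv:1512.06894 pp. 10–11); [MilneADT2006] I
Cor. 2.3, Thm. 2.8, Thm. 4.10(b), Lemma 6.15; [PoonenRains2012] Prop. 4.8/4.10; [Castella2018] (3.2.1).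
-/

noncomputable section

open scoped Classical

universe u

namespace Summit.BirchSwinnertonDyer.Rank1Residual.X11b.Relaxation

open WeierstrassCurve Literature.NumberTheory.EllipticCurves Literature.NumberTheory.GaloisRepresentations
  Literature.NumberTheory.GaloisCohomology Field Function NumberField IsDedekindDomain
open Literature.NumberTheory.GaloisRepresentations.DiscreteGaloisModule (mu MuCarrier)
open Summit.BirchSwinnertonDyer.Rank1Residual.X11b.FiniteDuality
open scoped ContRepresentation

-- Cup products need `LocallyCompactSpace Γ`; as in the tree's cup-product files, the compactness of
-- absolute Galois groups is a local instance only.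
attribute [local instance] absoluteGaloisGroup_compactSpace

variable {K : Type u} [Field K] [NumberField K] (W : WeierstrassCurve K) [W.IsElliptic]
variable (n : ℕ) [NeZero n] (v₀ : HeightOneSpectrum (𝓞 K))

attribute [local instance] finite_geomTorsion_of_neZero Literature.NumberTheory.EllipticCurves.finite_muCarrier

/-- The local Weil cup product at a place `v` as a bi-additive map on `H¹(K_v, E[n])` (bundled like
the tree's `localTatePairing`). [folklore] -/
def weilLocalPairing (e : geomTorsion W n → geomTorsion W n → AlgebraicClosure K)
    (hμ : ∀ S T, e S T ^ n = 1)
    (hadd₁ : ∀ S₁ S₂ T, e (S₁ + S₂) T = e S₁ T * e S₂ T)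
    (hadd₂ : ∀ S T₁ T₂, e S (T₁ + T₂) = e S T₁ * e S T₂)
    (hgal : ∀ (σ : absoluteGaloisGroup K) (S T : geomTorsion W n), σ • e S T = e (σ • S) (σ • T))
    (v : Place K) :
    galoisCohomology ((W.torsionGaloisModule n).toLocal v) 1 →+
      galoisCohomology ((W.torsionGaloisModule n).toLocal v) 1 →+
        galoisCohomology ((mu K n).toLocal v) 2 where
  toFun x := ((weilContPairingLocal W n e hμ hadd₁ hadd₂ hgal v).cupProduct x).toAddMonoidHom
  map_zero' := AddMonoidHom.ext fun y =>
    DFunLike.congr_fun (map_zero (weilContPairingLocal W n e hμ hadd₁ hadd₂ hgal v).cupProduct) y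
  map_add' x x' := AddMonoidHom.ext fun y =>
    DFunLike.congr_fun (map_add (weilContPairingLocal W n e hμ hadd₁ hadd₂ hgal v).cupProduct x x') y

/-- The local Weil cup product at a place `v` followed by `inv_v`, as a bi-additive `ℤ/n`-valued pairing
on `H¹(K_v, E[n])`. [folklore] -/
def invWeilPairing (e : geomTorsion W n → geomTorsion W n → AlgebraicClosure K)
    (hμ : ∀ S T, e S T ^ n = 1)
    (hadd₁ : ∀ S₁ S₂ T, e (S₁ + S₂) T = e S₁ T * e S₂ T)
    (hadd₂ : ∀ S T₁ T₂, e S (T₁ + T₂) = e S T₁ * e S T₂)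
    (hgal : ∀ (σ : absoluteGaloisGroup K) (S T : geomTorsion W n), σ • e S T = e (σ • S) (σ • T))
    (inv : LocalInvariants K n) (v : Place K) :
    galoisCohomology ((W.torsionGaloisModule n).toLocal v) 1 →+
      galoisCohomology ((W.torsionGaloisModule n).toLocal v) 1 →+ ZMod n where
  toFun x := (inv v).comp (weilLocalPairing W n e hμ hadd₁ hadd₂ hgal v x)
  map_zero' := by rw [map_zero, AddMonoidHom.comp_zero]
  map_add' x x' := by rw [map_add, AddMonoidHom.comp_add]

omit [W.IsElliptic] in
/-- Unfolding `invWeilPairing`: `(x, y) ↦ inv_v (x ∪ₑ y)`. [folklore] -/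
theorem invWeilPairing_apply (e : geomTorsion W n → geomTorsion W n → AlgebraicClosure K)
    (hμ : ∀ S T, e S T ^ n = 1)
    (hadd₁ : ∀ S₁ S₂ T, e (S₁ + S₂) T = e S₁ T * e S₂ T)
    (hadd₂ : ∀ S T₁ T₂, e S (T₁ + T₂) = e S T₁ * e S T₂)
    (hgal : ∀ (σ : absoluteGaloisGroup K) (S T : geomTorsion W n), σ • e S T = e (σ • S) (σ • T))
    (inv : LocalInvariants K n) (v : Place K)
    (x y : galoisCohomology ((W.torsionGaloisModule n).toLocal v) 1) :
    invWeilPairing W n e hμ hadd₁ hadd₂ hgal inv v x y =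
      inv v ((weilContPairingLocal W n e hμ hadd₁ hadd₂ hgal v).cupProduct x y) := rfl

section WithPairing

variable (e : geomTorsion W n → geomTorsion W n → AlgebraicClosure K)
  (hμ : ∀ S T, e S T ^ n = 1)
  (hadd₁ : ∀ S₁ S₂ T, e (S₁ + S₂) T = e S₁ T * e S₂ T)
  (hadd₂ : ∀ S T₁ T₂, e S (T₁ + T₂) = e S T₁ * e S T₂)
  (hgal : ∀ (σ : absoluteGaloisGroup K) (S T : geomTorsion W n), σ • e S T = e (σ • S) (σ • T))
  (halt : ∀ T, e T T = 1) (hnondeg : ∀ T, (∀ S, e S T = 1) → T = 0)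
  (inv : LocalInvariants K n)

include halt in
/-- **Isotropy**: `inv_v (x ∪ₑ y) = 0` for `x, y` in the local Kummer condition `𝓛_v`, at every place
(the tree's `cupProduct_eq_zero_of_mem_kummerSelmerStructure_of_fact` with the discharged
Poonen–Rains isotropy `kummerClass_cupProduct_kummerClass_eq_zero_holds`).
[cite: PoonenRains2012, Prop. 4.8 and Cor. 4.6] -/
theorem invWeilPairing_eq_zero_of_mem (v : Place K)
    {x y : galoisCohomology ((W.torsionGaloisModule n).toLocal v) 1}
    (hx : x ∈ W.kummerSelmerStructure n v) (hy : y ∈ W.kummerSelmerStructure n v) :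
    invWeilPairing W n e hμ hadd₁ hadd₂ hgal inv v x y = 0 := by
  rw [invWeilPairing_apply]
  have h := W.cupProduct_eq_zero_of_mem_kummerSelmerStructure_of_fact n e
    (Int.natCast_ne_zero.mpr (NeZero.ne n)) v
    (kummerClass_cupProduct_kummerClass_eq_zero_holds (Place.Completion v)) hμ hadd₁ hadd₂ halt hgal hx hy
  exact (congrArg (inv v) h).trans (map_zero _)

/-- Global Kummer classes localise into the local Kummer condition at every place. [folklore] -/
theorem localization_kummerMapTorsion_mem (v : Place K) (P : W.toAffine.Point) :
    galoisCohomology.localization (W.torsionGaloisModule n) v 1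
        (kummerMapTorsion W n (W.zsmul_geomPoints_surjective_holds
          (Int.natCast_ne_zero.mpr (NeZero.ne n))) P) ∈ W.kummerSelmerStructure n v := by
  haveI := charZero_placeCompletion (K := K) v
  change galoisCohomology.res (W.torsionGaloisModule n) (Place.Completion v) 1 _ ∈
    W.kummerLocalConditionAt n (Place.Completion v)
  rw [KummerIndex.res_kummerMapTorsion_eq_localKummerMap W (Place.Completion v)
    (Int.natCast_ne_zero.mpr (NeZero.ne n))]
  exact W.localKummerMap_mem _ _ _

include halt in
/-- **Reciprocity**: for `x ∈ H¹(K, E[n])` satisfying the Kummer condition at every place `v ≠ v₀`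
(`x ∈ kummerOutside W n {v₀}`) and every `P ∈ E(K)`, `inv_{v₀}(loc_{v₀} x ∪ₑ loc_{v₀} κ(P)) = 0`:
all other local terms of the Poitou–Tate sum vanish by isotropy, hence so does the one at `v₀`
(`sum_inv_weilCupProduct_localization_eq_zero`). [cite: MilneADT2006, Ch. I, Thm. 4.10(b)]
[cite: JetchevSkinnerWan2017, Prop. 3.2.1 (proof)] -/
theorem invWeilPairing_localization_eq_zero_of_mem_kummerOutside (hPT : inv.SumLocalTermEqZero)
    (v₀ : Place K) {x : galoisCohomology (W.torsionGaloisModule n) 1} (hx : x ∈ kummerOutside W n {v₀})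
    (P : W.toAffine.Point) :
    invWeilPairing W n e hμ hadd₁ hadd₂ hgal inv v₀
      (galoisCohomology.localization (W.torsionGaloisModule n) v₀ 1 x)
      (galoisCohomology.localization (W.torsionGaloisModule n) v₀ 1
        (kummerMapTorsion W n (W.zsmul_geomPoints_surjective_holds
          (Int.natCast_ne_zero.mpr (NeZero.ne n))) P)) = 0 := by
  have hS : ∀ v ∉ ({v₀} : Finset (Place K)), inv v ((weilContPairingLocal W n e hμ hadd₁ hadd₂ hgal v).cupProduct
      (galoisCohomology.localization (W.torsionGaloisModule n) v 1 x)
      (galoisCohomology.localization (W.torsionGaloisModule n) v 1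
        (kummerMapTorsion W n (W.zsmul_geomPoints_surjective_holds
          (Int.natCast_ne_zero.mpr (NeZero.ne n))) P))) = 0 := by
    intro v hv
    have hxv : galoisCohomology.localization (W.torsionGaloisModule n) v 1 x ∈ W.kummerSelmerStructure n v :=
      (mem_kummerOutside_iff W n {v₀} x).mp hx v hv
    exact invWeilPairing_eq_zero_of_mem W n e hμ hadd₁ hadd₂ hgal halt inv v hxv
      (localization_kummerMapTorsion_mem W n v P)
  have h := sum_inv_weilCupProduct_localization_eq_zero W n e hμ hadd₁ hadd₂ hgal inv hPT x
    (kummerMapTorsion W n (W.zsmul_geomPoints_surjective_holds (Int.natCast_ne_zero.mpr (NeZero.ne n))) P)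
    {v₀} hS
  rwa [Finset.sum_singleton] at h

/-! ### Counting at a finite place `v₀` -/

variable (v₀' : HeightOneSpectrum (𝓞 K))

include hnondeg in
/-- The pairing `inv_{v₀}(· ∪ₑ ·)` on `H¹(K_{v₀}, E[n])` has bijective left adjoint when `inv_{v₀}` is
injective (local Tate duality for `E[n]`, the tree's PROVED `localDuality_bijective` through
`eq_zero_of_forall_weilCupProduct_eq_zero_inr`, plus counting `#Hom(A, ℤ/n) = #A`). [cite: MilneADT2006, Ch. I, Cor. 2.3] -/
theorem invWeilPairing_bijective (hinv : Injective (inv (Sum.inr v₀'))) :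
    Bijective (invWeilPairing W n e hμ hadd₁ hadd₂ hgal inv (Sum.inr v₀')) := by
  haveI : CharZero (v₀'.adicCompletion K) := charZero_adicCompletion v₀'
  haveI : Finite (galoisCohomology ((W.torsionGaloisModule n).toLocal (Sum.inr v₀')) 1) := by
    change Finite (galoisCohomology (GaloisRep.restrictField (v₀'.adicCompletion K) (W.torsionGaloisModule n)) 1)
    exact finite_galoisCohomology_one_of_isNonarchimedeanLocalField _
  have hA : ∀ x : galoisCohomology ((W.torsionGaloisModule n).toLocal (Sum.inr v₀')) 1, n • x = 0 :=
    nsmul_continuousCohomology_one_eq_zero _ n (fun T : geomTorsion W n => AddSubgroup.torsionBy.nsmul T)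
  haveI := finite_addMonoidHom_zmod (galoisCohomology ((W.torsionGaloisModule n).toLocal (Sum.inr v₀')) 1) n
  have hinj : Injective (invWeilPairing W n e hμ hadd₁ hadd₂ hgal inv (Sum.inr v₀')) := by
    intro x x' h
    rw [← sub_eq_zero]
    refine eq_zero_of_forall_weilCupProduct_eq_zero_inr W n e hμ hadd₁ hadd₂ v₀' hgal hnondeg _ fun y => ?_
    have h1 : invWeilPairing W n e hμ hadd₁ hadd₂ hgal inv (Sum.inr v₀') (x - x') y = 0 := by
      rw [map_sub, h, sub_self, AddMonoidHom.zero_apply]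
    rw [invWeilPairing_apply] at h1
    exact hinv (h1.trans (map_zero _).symm)
  exact hinj.bijective_of_nat_card_le (Nat.card_addMonoidHom_zmod hA).le

end WithPairing

section Main

/-- **RELAXING THE SELMER CONDITION AT ONE FINITE PLACE COSTS AT MOST THE LOCAL INDEX OF THE GLOBAL
POINTS.** For an elliptic curve `E = W` over a number field `K`, a prime power `n`, a finite place `v₀`,
the Poitou–Tate family `inv` (named fact `poitouTate_sum_localTatePairing_eq_zero`: `IsPerfect` and
`SumLocalTermEqZero`) and Tate's local Euler–Poincaré characteristic at `K_{v₀}` (named fact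
`localEulerPoincareCharacteristic`, through the count `#H¹(K_{v₀}, E[n]) = #𝓛_{v₀}²`):

  `[H¹_{𝓛, ⊤ at v₀}(K, E[n]) : Sel⁽ⁿ⁾(E/K)] ≤ [E(K_{v₀}) : n E(K_{v₀}) + im E(K)]`,

where `H¹_{𝓛, ⊤ at v₀} = kummerOutside W n {v₀}` (Kummer condition at every place except `v₀`).
Proof: `x ↦ loc_{v₀} x` embeds the quotient into `(loc(H¹_{𝓛,⊤}) + 𝓛_{v₀})/𝓛_{v₀} ⊆ N/𝓛_{v₀}`, `N` the
annihilator of `loc(κ E(K))` under `inv_{v₀}(· ∪ₑ ·)` (reciprocity + isotropy); `#N·#loc(κE(K)) =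
#H¹(K_{v₀},E[n]) = #𝓛²` (perfectness + Euler characteristic), so `[N : 𝓛] = [𝓛 : loc κE(K)] =
[E(K_{v₀}) : nE(K_{v₀}) + im E(K)]` (the Kummer index). This is the duality half of
Jetchev–Skinner–Wan 2017 Prop. 3.2.1 ("`#im α = #coker β`", `≤` direction) at finite level.
[cite: JetchevSkinnerWan2017, Prop. 3.2.1 (proof, arXiv:1512.06894 pp. 10–11)] [cite: MilneADT2006, Ch. I, Thm. 4.10(b), Cor. 2.3, Thm. 2.8] -/
theorem relIndex_selmerGroup_kummerOutside_le (hn2 : 2 ≤ n)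
    (inv : LocalInvariants K n) (hperf : inv.IsPerfect) (hPT : inv.SumLocalTermEqZero)
    (hEuler : Nat.card (galoisCohomology ((W.torsionGaloisModule n).toLocal (Sum.inr v₀)) 1) =
      (Nat.card (nsmulAddMonoidHom n : (W.baseChange (v₀.adicCompletion K)).toAffine.Point →+ _).ker *
        Nat.card (v₀.adicCompletionIntegers K ⧸ Ideal.span {(n : v₀.adicCompletionIntegers K)})) ^ 2) :
    (selmerGroup W (n : ℤ)).relIndex (kummerOutside W n {Sum.inr v₀}) ≤
      ((Affine.Point.baseChange (W' := W) K (v₀.adicCompletion K)).range ⊔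
        (zsmulAddGroupHom (n : ℤ) : (W.baseChange (v₀.adicCompletion K)).toAffine.Point →+ _).range).index := by
  classical
  haveI : PerfectField K := PerfectField.ofCharZero
  haveI : CharZero (v₀.adicCompletion K) := charZero_adicCompletion v₀
  have hnZ : (n : ℤ) ≠ 0 := Int.natCast_ne_zero.mpr (NeZero.ne n)
  obtain ⟨e, hμ, hadd₁, hadd₂, halt, hnondeg, hgal⟩ :=
    exists_weilPairing_holds W n hn2 (by exact_mod_cast NeZero.ne n)
  -- notation
  set M := W.torsionGaloisModule n with hM
  set loc := galoisCohomology.localization M (Sum.inr v₀) 1 with hloc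
  set b := invWeilPairing W n e hμ hadd₁ hadd₂ hgal inv (Sum.inr v₀) with hb
  set L := W.kummerSelmerStructure n (Sum.inr v₀) with hL
  set KO := kummerOutside W n {Sum.inr v₀} with hKO
  set hdiv := W.zsmul_geomPoints_surjective_holds hnZ
  set Hκ := ((kummerMapTorsion W n hdiv).range).map loc with hHκ
  set N := annLeft b Hκ with hN
  haveI hfinA : Finite (galoisCohomology (M.toLocal (Sum.inr v₀)) 1) := by
    change Finite (galoisCohomology (GaloisRep.restrictField (v₀.adicCompletion K) (W.torsionGaloisModule n)) 1)
    exact finite_galoisCohomology_one_of_isNonarchimedeanLocalField _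
  -- (1) `Sel = comap L ⊓ KO`
  have hSel : selmerGroup W (n : ℤ) = L.comap loc ⊓ KO := by
    apply le_antisymm
    · intro c hc
      exact ⟨(W.mem_selmerGroup_iff_forall_localization_mem n c).mp hc (Sum.inr v₀),
        selmerGroup_le_kummerOutside W n _ hc⟩
    · rintro c ⟨hc₀, hcKO⟩
      refine mem_selmerGroup_of_mem_kummerOutside W n hcKO fun v => ?_
      obtain ⟨v, hv⟩ := v
      rw [Finset.mem_singleton] at hv
      subst hv
      exact hc₀
  -- (2) the relative index through `loc`
  have h2' : (L.comap loc ⊓ KO).relIndex KO = L.relIndex (L ⊔ KO.map loc) := by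
    rw [AddSubgroup.inf_relIndex_right, AddSubgroup.relIndex_comap, AddSubgroup.relIndex_sup_left]
  have h2 : (selmerGroup W (n : ℤ)).relIndex KO = L.relIndex (L ⊔ KO.map loc) := by
    rw [hSel]; exact h2'
  -- (3) `KO.map loc ≤ N` and `L ≤ N`, `Hκ ≤ L`
  have hHκL : Hκ ≤ L := by
    rintro _ ⟨_, ⟨P, rfl⟩, rfl⟩
    exact localization_kummerMapTorsion_mem W n (Sum.inr v₀) P
  have hKON : KO.map loc ≤ N := by
    rintro _ ⟨x, hx, rfl⟩
    rw [hN, mem_annLeft_iff]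
    rintro _ ⟨_, ⟨P, rfl⟩, rfl⟩
    exact invWeilPairing_localization_eq_zero_of_mem_kummerOutside W n e hμ hadd₁ hadd₂ hgal halt inv hPT
      (Sum.inr v₀) hx P
  have hLN : L ≤ N := by
    intro x hx
    rw [hN, mem_annLeft_iff]
    intro y hy
    exact invWeilPairing_eq_zero_of_mem W n e hμ hadd₁ hadd₂ hgal halt inv (Sum.inr v₀) hx (hHκL hy)
  have hXN : L ⊔ KO.map loc ≤ N := sup_le hLN hKON
  -- (4) `[L ⊔ loc KO : L] ≤ [N : L]`
  haveI : Finite N := inferInstance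
  have hXNne : (L ⊔ KO.map loc).relIndex N ≠ 0 := AddSubgroup.FiniteIndex.index_ne_zero
  have h4 : L.relIndex (L ⊔ KO.map loc) ≤ L.relIndex N := by
    have := AddSubgroup.relIndex_mul_relIndex L (L ⊔ KO.map loc) N le_sup_left hXN
    exact Nat.le_of_dvd (Nat.pos_of_ne_zero (by
      rw [← this]; exact mul_ne_zero (by
        intro h0; rw [h0, zero_mul] at this
        exact (AddSubgroup.FiniteIndex.index_ne_zero (H := L.addSubgroupOf N)) this.symm) hXNne))
      (Dvd.intro _ this)
  -- (5) `#N · #Hκ = #A = #L²`, so `[N : L] = [L : Hκ]`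
  have hA : ∀ x : galoisCohomology (M.toLocal (Sum.inr v₀)) 1, n • x = 0 :=
    nsmul_continuousCohomology_one_eq_zero _ n (fun T : geomTorsion W n => AddSubgroup.torsionBy.nsmul T)
  have hbij : Bijective b := invWeilPairing_bijective W n e hμ hadd₁ hadd₂ hgal hnondeg inv v₀ (hperf v₀).1.1
  have hNH : Nat.card N * Nat.card Hκ = Nat.card (galoisCohomology (M.toLocal (Sum.inr v₀)) 1) :=
    natCard_annLeft_mul hA b hbij Hκ
  have hLcard : Nat.card L = Nat.card (nsmulAddMonoidHom n :
        (W.baseChange (v₀.adicCompletion K)).toAffine.Point →+ _).ker *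
      Nat.card (v₀.adicCompletionIntegers K ⧸ Ideal.span {(n : v₀.adicCompletionIntegers K)}) :=
    W.natCard_kummerSelmerStructure_inr v₀ (NeZero.ne n)
  have hAL : Nat.card (galoisCohomology (M.toLocal (Sum.inr v₀)) 1) = Nat.card L * Nat.card L := by
    rw [hEuler, hLcard, sq]
  -- `[N : L] · #L = #N`, `[L : Hκ] · #Hκ = #L`
  have hNL : L.relIndex N * Nat.card L = Nat.card N := by
    rw [AddSubgroup.relIndex, mul_comm, ← Nat.card_congr (AddSubgroup.addSubgroupOfEquivOfLe hLN).toEquiv]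
    exact AddSubgroup.card_mul_index _
  have hLH : Hκ.relIndex L * Nat.card Hκ = Nat.card L := by
    rw [AddSubgroup.relIndex, mul_comm, ← Nat.card_congr (AddSubgroup.addSubgroupOfEquivOfLe hHκL).toEquiv]
    exact AddSubgroup.card_mul_index _
  have hLpos : 0 < Nat.card L := Nat.card_pos
  have hHpos : 0 < Nat.card Hκ := Nat.card_pos
  have h5 : L.relIndex N = Hκ.relIndex L := by
    have key : L.relIndex N * Nat.card L * Nat.card Hκ = Hκ.relIndex L * Nat.card Hκ * Nat.card L := by
      rw [hNL, hNH, hAL, hLH]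
    have : L.relIndex N * (Nat.card L * Nat.card Hκ) = Hκ.relIndex L * (Nat.card L * Nat.card Hκ) := by
      rw [← mul_assoc, key]; ring
    exact Nat.eq_of_mul_eq_mul_right (Nat.mul_pos hLpos hHpos) this
  -- (6) the Kummer index
  have h6 : Hκ.relIndex L = ((Affine.Point.baseChange (W' := W) K (v₀.adicCompletion K)).range ⊔
      (zsmulAddGroupHom (n : ℤ) : (W.baseChange (v₀.adicCompletion K)).toAffine.Point →+ _).range).index := by
    change (((kummerMapTorsion W n hdiv).range).map
        (galoisCohomology.res (W.torsionGaloisModule n) (v₀.adicCompletion K) 1)).relIndex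
        (W.kummerLocalConditionAt n (v₀.adicCompletion K)) = _
    exact KummerIndex.relIndex_map_res_range_kummerMapTorsion W (v₀.adicCompletion K) hnZ hdiv
  calc (selmerGroup W (n : ℤ)).relIndex KO = L.relIndex (L ⊔ KO.map loc) := h2
    _ ≤ L.relIndex N := h4
    _ = Hκ.relIndex L := h5
    _ = _ := h6

/-- **The same from the two NAMED FACTS** — Poitou–Tate (`poitouTate_sum_localTatePairing_eq_zero K`,
Milne I Thm. 4.10(b) with Cor. 2.3) and Tate's local Euler–Poincaré characteristic at `K_{v₀}`
(`localEulerPoincareCharacteristic`, Milne I Thm. 2.8) — for a prime power `n`: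
`[H¹_{𝓛, ⊤ at v₀}(K, E[n]) : Sel⁽ⁿ⁾(E/K)] ≤ [E(K_{v₀}) : nE(K_{v₀}) + im E(K)]`.
[cite: JetchevSkinnerWan2017, Prop. 3.2.1 (proof, arXiv:1512.06894 pp. 10–11)] [cite: MilneADT2006, Ch. I, Thm. 4.10(b) and Thm. 2.8] -/
theorem relIndex_selmerGroup_kummerOutside_le_of_facts (hn : IsPrimePow n)
    (hPT : poitouTate_sum_localTatePairing_eq_zero K)
    (hEP : localEulerPoincareCharacteristic (v₀.adicCompletion K)) :
    (selmerGroup W (n : ℤ)).relIndex (kummerOutside W n {Sum.inr v₀}) ≤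
      ((Affine.Point.baseChange (W' := W) K (v₀.adicCompletion K)).range ⊔
        (zsmulAddGroupHom (n : ℤ) : (W.baseChange (v₀.adicCompletion K)).toAffine.Point →+ _).range).index := by
  obtain ⟨inv, hperf, hsum⟩ := hPT n
  have hn2 : 2 ≤ n := by
    obtain ⟨p, k, hp, hk, rfl⟩ := hn
    calc 2 ≤ p := (Nat.prime_iff.mpr hp).two_le
      _ = p ^ 1 := (pow_one p).symm
      _ ≤ p ^ k := Nat.pow_le_pow_right (Nat.prime_iff.mpr hp).pos hk
  exact relIndex_selmerGroup_kummerOutside_le W n v₀ hn2 inv hperf hsum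
    (natCard_galoisCohomology_one_torsion_adicCompletion_eq_sq W v₀ n hn hEP)

end Main

end Summit.BirchSwinnertonDyer.Rank1Residual.X11b.Relaxation

end
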